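import Summits.Langlands.Langlands.Theses.OrdinaryPrimeTransport
import Literature.NumberTheory.Automorphic.WeaklyRegularGaloisRep
import Literature.NumberTheory.Automorphic.QuadraticBaseChangeFrobCompatibleProofs
import Literature.NumberTheory.Automorphic.AutomorphicRepsGLSatakeFlathProofs
import HarnessLib

/-!
# SKELETON — line `MultiplicityThreePolarizableSatakeA` for the crux `ReciprocityUpToIrreducibility`
# (item stmt-Langlands-14328; routes IrreducibilityBySelfDuality / OrdinaryPrimeTransport)
# forward generator G4 ladder-down, generation 33 (unit fwd2-ladder-Langlands-14328-g33)

Dial θ33 = the MAXIMAL ARCHIMEDEAN MULTIPLICITY `m` of the infinitesimal character (`max_{σ,a} #{i : λ_{i,σ} = a}`)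
of a cuspidal, C-algebraic, conjugate self-dual (`π^c ≅ π^∨`), odd (Asai sign `+1`) `π` on `GL_n(𝔸_K)`, `K` CM,
inside clause (A) of the top E = `ReciprocityUpToIrreducibility` (C-normalised, almost-everywhere Satake form:
`charpoly ρ(Frob_v) = ∏ (X - ι⁻¹(q_v^{(n-1)/2} αᵢ)⁻¹)` at almost every unramified `v ∤ ℓ`).

* `m = 1` regular (Clozel, HLTT/Scholze — inside the floor);
* `m ≤ 2` = WEAKLY REGULAR = the FLOOR: Fakhruddin–Pilloni, Thm. 9.10 (in-tree named fact
  `FakhruddinPilloni2021_galoisRep_of_weaklyRegular_odd`, `floor_two`, one `obtain`);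
* `m = 3` = THE RUNG `MultiplicityThreePolarizableSatakeA` (`stub_rung`): the first cell in which `π_w` may be a
  DEGENERATE limit of discrete series or not a limit of discrete series at all for every `U(p,q)` (for `n = 3`,
  `π_w ≅ Ind(χ,χ,χ)`: the infinitesimal character of a character) — invisible to every (coherent or Betti)
  cohomology theory of unitary Shimura varieties (`Literature.Barriers.Langlands.NonRegularWeightBarrier`,
  Goldring 2016 §4.4.1–4.4.2);
* `m ≥ 4` = `stub_higherMultiplicities`; `m = ∞` = the target `DegenerateLimits.OddPolarizableSatakeA`.

Five registered stubs and the kernel-checked composition `ReciprocityUpToIrreducibility_of` concluding the crux BY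
NAME (TREE COPY convention of g14–g32: this file concludes route OrdinaryPrimeTransport's decl
`Summit.Langlands.Langlands.Theses.OrdinaryPrimeTransport.ReciprocityUpToIrreducibility`, which is the shared item
stmt-Langlands-14328 — the IrreducibilityBySelfDuality decl is the same text, `Iff.rfl`):

* `stub_floorFact : FakhruddinPilloni2021_galoisRep_of_weaklyRegular_odd` — the floor cells `m ≤ 2` as the TEXT in
  print (named fact, hypothesis-grade in the tree);
* `stub_rung : MultiplicityThreePolarizableSatakeA` — THE RUNG (first open cell, `m = 3`);
* `stub_higherMultiplicities : HigherMultiplicities` — the cells `m ≥ 4` (open; the rest of the graded family);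
* `stub_sectorMerge : (∀ m, family m) → SectorAutomorphicToGalois` — upgrade C-normalised a.e.-Satake existence on
  the whole odd-polarizable CM sector to clause (A) of E VERBATIM (L-algebraic twist, `IsGeometricFramed` incl. de
  Rham above `ℓ` for the pinned Fontaine datum, `Corresponds` at every finite place) for every `Rec`;
* `stub_offSector : OffSectorReciprocity` — E with clause (A) restricted OFF the sector (the honest complement).

Composition: `Rec`, clause (B) and off-sector (A) from `stub_offSector`; on-sector (A) by `stub_sectorMerge` fed with
the whole family (`family_of` = floor ⊕ rung ⊕ higher cells, `interval`-free case split).  Sorries ONLY inside the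
five `stub_*`.  Also recorded sorry-free: `family_of_top : E → family m` (every cell is a consequence of the top —
twist by `|det|^{-(n-1)/2}`, uniqueness of Satake parameters, `arithFrobPolyOfSatake_map_cpow_neg_half`) and
`MultiplicityThreePolarizableSatakeA_of_top : E → rung`.
-/

noncomputable section

set_option linter.dupNamespace false

open scoped MatrixGroups Matrix NumberField Polynomial Classical
open Filter IsDedekindDomain Field Polynomial NumberField
open Literature.NumberTheory.Automorphic Literature.NumberTheory.GaloisRepresentations
open Literature.NumberTheory.PAdicHodge
open Summit.Langlands

namespace Summit.Langlands.Langlands.Cruxes.ReciprocityUpToIrreducibility.MultiplicityThreePolarizableSatakeA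

/-! ## 1. The graded family and the rung -/

/-- **Clause (A), a.e.-Satake form, C-normalisation, for odd polarizable `π` over CM fields whose archimedean
exponents have multiplicity `≤ m`.**  For `K` CM, `π` cuspidal on `GL_n(𝔸_K)` (`n ≥ 1`) with a C-algebraic
infinity type `T` such that at every complex embedding every exponent `λ_{i,σ}` of the infinitesimal character
occurs with multiplicity `≤ m` (for `m ≤ 2` phrased as Fakhruddin–Pilloni's *weak regularity*), `π^c ≅ π^∨`
(`IsEssConjSelfDual π 1`) and `π` odd (Asai sign `+1`): for every `ℓ`, `ι : ℚ̄_ℓ ≃ ℂ` there is a continuous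
`r : Γ_K → GL_n(ℚ̄_ℓ)` which at almost every finite place `v ∤ ℓ` where `π_v` has Satake parameter `α` is
unramified with `charpoly r(Frob_v) = arithFrobPolyOfSatake ι q_v n α` (the formula of Fakhruddin–Pilloni
Thm. 9.10 / HLTT Thm. A verbatim). [cite: FakhruddinPilloni2021, Thm. 9.10] [cite: Goldring2016, §4.4.1] -/
def PolarizableMultiplicitySatakeA (m : ℕ) : Prop :=
  ∀ (n : ℕ) (K : Type) [Field K] [NumberField K] [IsCMField K]
    (hcpt : isCompact_glFiniteIntegralLevel n K) (π : CuspidalAutomorphicRepData n K hcpt)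
    (T : InfinityType K n), 0 < n → π.1.HasInfinityType T → T.IsCAlgebraic →
      (m ≤ 2 → T.IsWeaklyRegular) →
      (∀ (σ : K →+* ℂ) (a : ℂ), ((T σ).map ArchWeight.a).count a ≤ m) →
      π.1.IsEssConjSelfDual 1 → π.1.HasAsaiSign (NumberField.IsCMField.complexConj K) 1 →
        ∀ (ℓ : ℕ) [Fact ℓ.Prime] (ι : PadicAlgCl ℓ ≃+* ℂ),
          ∃ r : FramedGaloisRep K (PadicAlgCl ℓ) n,
            ∀ᶠ v : HeightOneSpectrum (𝓞 K) in cofinite, ∀ α : Multiset ℂ, π.1.HasSatakeParamAt v α →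
              ((ℓ : ℕ) : 𝓞 K) ∉ v.asIdeal →
                r.IsUnramifiedAt v ∧ r.HasFrobCharpolyAt v (arithFrobPolyOfSatake ι v.residueCard n α)

/-- **THE RUNG** (`m = 3`): the first cell past weak regularity. -/
def MultiplicityThreePolarizableSatakeA : Prop := PolarizableMultiplicitySatakeA 3

/-- The higher cells `m ≥ 4` of the graded family (open). -/
def HigherMultiplicities : Prop := ∀ m : ℕ, 4 ≤ m → PolarizableMultiplicitySatakeA m

/-! ## 2. Monotonicity and the floor -/

/-- The family is antitone in `m` (larger `m` admits more `π`). -/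
theorem antitone {m m' : ℕ} (hmm' : m ≤ m') (h : PolarizableMultiplicitySatakeA m') :
    PolarizableMultiplicitySatakeA m := by
  intro n K _ _ _ hcpt π T hn hT hC hW hmult hsd hodd ℓ _ ι
  exact h n K hcpt π T hn hT hC (fun h2 => hW (hmm'.trans h2))
    (fun σ a => (hmult σ a).trans hmm') hsd hodd ℓ ι

/-- **Floor** `m = 2` from Fakhruddin–Pilloni Thm. 9.10 (the in-tree named fact; verbatim hypotheses, its
conclusion at every unramified `v ∤ ℓ` implies ours at almost every one). [cite: FakhruddinPilloni2021, Thm. 9.10] -/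
theorem floor_two (h : FakhruddinPilloni2021_galoisRep_of_weaklyRegular_odd) :
    PolarizableMultiplicitySatakeA 2 := by
  intro n K _ _ _ hcpt π T _hn hT hC hW _hmult hsd hodd ℓ _ ι
  obtain ⟨r, hr⟩ := h n K hcpt π T hT hC (hW le_rfl) hsd hodd ℓ ι
  exact ⟨r, Eventually.of_forall hr⟩

/-- Every cell `m ≤ 2` from the floor. -/
theorem of_le_two {m : ℕ} (hm : m ≤ 2) (h : FakhruddinPilloni2021_galoisRep_of_weaklyRegular_odd) :
    PolarizableMultiplicitySatakeA m :=
  antitone hm (floor_two h)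

/-! ## 3. The sector, its merge target and the off-sector complement -/

/-- `π₀` on `GL_n(𝔸_K)`, `K` CM, is **odd polarizable C-algebraic**: it has a C-algebraic infinity type, `π₀^c ≅ π₀^∨`
and Asai sign `+1`. [cite: FakhruddinPilloni2021, §9.1] -/
def IsOddPolarizableCAlg (K : Type) [Field K] [NumberField K] [IsCMField K] {n : ℕ}
    {hcpt : isCompact_glFiniteIntegralLevel n K} (π₀ : CuspidalAutomorphicRepData n K hcpt) : Prop :=
  ∃ T₀ : InfinityType K n, π₀.1.HasInfinityType T₀ ∧ T₀.IsCAlgebraic ∧ π₀.1.IsEssConjSelfDual 1 ∧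
    π₀.1.HasAsaiSign (NumberField.IsCMField.complexConj K) 1

/-- **The odd-polarizable CM sector of clause (A)**: `F` is CM, `n ≥ 1`, and the (L-algebraic) `π` is the twist
`π₀ ⊗ |det|^{-(n-1)/2}` (`π.W = |det|^{-(n-1)/2} · π₀.W`) of an odd polarizable C-algebraic cuspidal `π₀`. -/
def InOddPolarizableSector (F : Type) [Field F] [NumberField F] {n : ℕ}
    {hcpt : isCompact_glFiniteIntegralLevel n F} (π : CuspidalAutomorphicRepData n F hcpt) : Prop :=
  ∃ (_ : IsCMField F) (_ : NeZero n) (π₀ : CuspidalAutomorphicRepData n F hcpt) (χ : HeckeCharacter F),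
    (∀ x : Literature.NumberTheory.GaloisRepresentations.ideleGroup F,
      ((χ x : ℂˣ) : ℂ) =
        (Literature.NumberTheory.GaloisRepresentations.ideleNorm x : ℂ) ^ (((-(((n : ℝ) - 1) / 2) : ℝ) : ℂ))) ∧
    π.1.W = π₀.1.W.map (mulChar (detTwist n χ)) ∧ π.1.W' = π₀.1.W'.map (mulChar (detTwist n χ)) ∧
    IsOddPolarizableCAlg F π₀

/-- **Merge target**: clause (A) of E VERBATIM (`IsGeometricFramed Rec ρ ∧ Corresponds Rec ι π ρ`) for EVERY
reciprocity datum `Rec`, on the odd-polarizable CM sector. -/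
def SectorAutomorphicToGalois : Prop :=
  ∀ (F : Type) [Field F] [NumberField F] (Rec : ReciprocityData F) (n : ℕ), 0 < n →
    ∀ (hcpt : isCompact_glFiniteIntegralLevel n F) (π : CuspidalAutomorphicRepData n F hcpt), π.1.IsLAlgebraic →
      InOddPolarizableSector F π → ∀ (ℓ : ℕ) [Fact ℓ.Prime] (ι : PadicAlgCl ℓ ≃+* ℂ),
        ∃ ρ : FramedGaloisRep F (PadicAlgCl ℓ) n, IsGeometricFramed Rec ρ ∧ Corresponds Rec ι π.1 ρ

/-- **The off-sector complement**: E (`ReciprocityUpToIrreducibility`) with clause (A) restricted to `π` NOT in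
the odd-polarizable CM sector and clause (B) entire. -/
def OffSectorReciprocity : Prop :=
  ∀ (F : Type) [Field F] [NumberField F], ∃ Rec : ReciprocityData F, ∀ n : ℕ, 0 < n →
    ∀ hcpt : isCompact_glFiniteIntegralLevel n F,
      (∀ π : CuspidalAutomorphicRepData n F hcpt, π.1.IsLAlgebraic → ¬ InOddPolarizableSector F π →
        ∀ (ℓ : ℕ) [Fact ℓ.Prime] (ι : PadicAlgCl ℓ ≃+* ℂ),
          ∃ ρ : FramedGaloisRep F (PadicAlgCl ℓ) n, IsGeometricFramed Rec ρ ∧ Corresponds Rec ι π.1 ρ) ∧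
      GaloisToAutomorphic n Rec hcpt

/-! ## 4. The five registered stubs -/

/-- The floor cells `m ≤ 2` — Fakhruddin–Pilloni Thm. 9.10, a theorem in print vendored as a named fact
(floor debt). [cite: FakhruddinPilloni2021, Thm. 9.10] -/
theorem stub_floorFact : FakhruddinPilloni2021_galoisRep_of_weaklyRegular_odd := by
  sorry

/-- **THE RUNG** `m = 3`: Galois representations (C-normalised a.e. Satake) for cuspidal C-algebraic conjugate
self-dual odd `π` on `GL_n` over a CM field some of whose archimedean exponents have multiplicity `3`.  OPEN. -/
theorem stub_rung : MultiplicityThreePolarizableSatakeA := by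
  sorry

/-- The cells `m ≥ 4` of the family (open). -/
theorem stub_higherMultiplicities : HigherMultiplicities := by
  sorry

/-- Sector merge: from C-normalised a.e.-Satake existence on the whole odd-polarizable CM sector (all `m`) to clause
(A) of E verbatim on the sector, for every `Rec` (L-algebraic twist; unramified a.e.; de Rham above `ℓ` against the
pinned Fontaine datum; local–global compatibility at every finite place). -/
theorem stub_sectorMerge :
    (∀ m : ℕ, PolarizableMultiplicitySatakeA m) → SectorAutomorphicToGalois := by
  sorry

/-- The honest complement: E off the odd-polarizable CM sector. -/
theorem stub_offSector : OffSectorReciprocity := by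
  sorry

/-! ## 5. Composition (no sorry below this line) -/

/-- The whole graded family from the floor text, the rung and the higher cells. -/
theorem family_of (hF : FakhruddinPilloni2021_galoisRep_of_weaklyRegular_odd)
    (h3 : MultiplicityThreePolarizableSatakeA) (h4 : HigherMultiplicities) (m : ℕ) :
    PolarizableMultiplicitySatakeA m := by
  by_cases h4m : 4 ≤ m
  · exact h4 m h4m
  · by_cases h3m : m = 3
    · subst h3m
      exact h3
    · exact of_le_two (by omega) hF

/-- **COMPOSITION — the crux BY NAME from the five stub statements.**  `Rec`, clause (B) and off-sector clause
(A) come from the off-sector statement; on-sector clause (A) is the merge of the whole family. -/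
theorem ReciprocityUpToIrreducibility_of :
    FakhruddinPilloni2021_galoisRep_of_weaklyRegular_odd → MultiplicityThreePolarizableSatakeA →
    HigherMultiplicities → ((∀ m : ℕ, PolarizableMultiplicitySatakeA m) → SectorAutomorphicToGalois) →
    OffSectorReciprocity →
    Summit.Langlands.Langlands.Theses.OrdinaryPrimeTransport.ReciprocityUpToIrreducibility := by
  intro hF h3 h4 hmerge hoff F _ _
  obtain ⟨Rec, hall⟩ := hoff F
  refine ⟨Rec, fun n hn hcpt => ⟨?_, (hall n hn hcpt).2⟩⟩
  intro π hL ℓ _ ι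
  by_cases hsec : InOddPolarizableSector F π
  · exact hmerge (family_of hF h3 h4) F Rec n hn hcpt π hL hsec ℓ ι
  · exact (hall n hn hcpt).1 π hL hsec ℓ ι

/-- The crux from the REGISTERED stubs (audit: proof-of-item modulo the five sorries). -/
theorem reciprocityUpToIrreducibility_of_stubs :
    Summit.Langlands.Langlands.Theses.OrdinaryPrimeTransport.ReciprocityUpToIrreducibility :=
  ReciprocityUpToIrreducibility_of stub_floorFact stub_rung stub_higherMultiplicities stub_sectorMerge
    stub_offSector

/-- **`<Crux>_proof`.** TREE COPY: concludes route OrdinaryPrimeTransport's decl of the shared item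
stmt-Langlands-14328.  The REGISTERED seat-folder copy (`line-MultiplicityThreePolarizableSatakeA.lean`, identical up
to one extra `import Summits.Langlands.Langlands.Theses.IrreducibilityBySelfDuality` and this theorem's type) concludes
`Summit.Langlands.Langlands.Theses.IrreducibilityBySelfDuality.ReciprocityUpToIrreducibility` BY NAME (the two decls are
the same text, definitionally equal — `lean check` rc 0, audit proof-of-item for route-Langlands-IrreducibilityBySelfDuality
modulo the five stubs; `ledger skeleton check` run on that copy); that module does not elaborate on the crux-write host
(`remote:incoherent … IrreducibilityBySelfDuality: mismatch`, 2026-08-20), as for Lines/RealQuadraticBigImageAbelianSurface. -/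
theorem ReciprocityUpToIrreducibility_proof :
    Summit.Langlands.Langlands.Theses.OrdinaryPrimeTransport.ReciprocityUpToIrreducibility :=
  reciprocityUpToIrreducibility_of_stubs

/-! ## 6. Every cell is a consequence of the top (sorry-free) -/

/-- The exponent `-(n-1)/2` as a real number. -/
abbrev halfShift (n : ℕ) : ℝ := -(((n : ℝ) - 1) / 2)

/-- `T.twist (-(n-1)/2)` of a C-algebraic `T` is L-algebraic (Buzzard–Gee §5.3). -/
theorem isLAlgebraic_twist_neg_half {K : Type} [Field K] {n : ℕ} {T : InfinityType K n}
    (hC : T.IsCAlgebraic) : (T.twist ((halfShift n : ℝ) : ℂ)).IsLAlgebraic := by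
  have e : ((halfShift n : ℝ) : ℂ) = (((n : ℂ) - 1) / 2) + (((-((n : ℤ) - 1) : ℤ)) : ℂ) := by
    simp only [halfShift]; push_cast; ring
  rw [e, ← InfinityType.twist_twist, InfinityType.isLAlgebraic_twist_intCast_iff]
  exact (InfinityType.isCAlgebraic_iff_isLAlgebraic_twist T).mp hC

/-- **The cell from clause (A) of a reciprocity datum** (the common core of `family_of_top` and of the on-path
theorem `Langlands → rung`): twist `π` by `|det|^{-(n-1)/2}` to an L-algebraic `π'`, take any `ρ` with
`Corresponds Rec ι π' ρ`, read its a.e. Satake clause and undo the twist on Satake parameters. -/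
theorem cell_of_clauseA {n : ℕ} {K : Type} [Field K] [NumberField K] [IsCMField K]
    {hcpt : isCompact_glFiniteIntegralLevel n K} (Rec : ReciprocityData K)
    (hA : ∀ π : CuspidalAutomorphicRepData n K hcpt, π.1.IsLAlgebraic →
      ∀ (ℓ : ℕ) [Fact ℓ.Prime] (ι : PadicAlgCl ℓ ≃+* ℂ),
        ∃ ρ : FramedGaloisRep K (PadicAlgCl ℓ) n, IsGeometricFramed Rec ρ ∧ Corresponds Rec ι π.1 ρ)
    (π : CuspidalAutomorphicRepData n K hcpt) (T : InfinityType K n) (hn : 0 < n)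
    (hT : π.1.HasInfinityType T) (hC : T.IsCAlgebraic) (ℓ : ℕ) [Fact ℓ.Prime] (ι : PadicAlgCl ℓ ≃+* ℂ) :
    ∃ r : FramedGaloisRep K (PadicAlgCl ℓ) n,
      ∀ᶠ v : HeightOneSpectrum (𝓞 K) in cofinite, ∀ α : Multiset ℂ, π.1.HasSatakeParamAt v α →
        ((ℓ : ℕ) : 𝓞 K) ∉ v.asIdeal →
          r.IsUnramifiedAt v ∧ r.HasFrobCharpolyAt v (arithFrobPolyOfSatake ι v.residueCard n α) := by
  haveI : NeZero n := ⟨hn.ne'⟩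
  obtain ⟨χ, π', hχ, hWt, hWt', hT'⟩ := π.exists_twist_hasInfinityType (halfShift n) hT
  have hLalg : π'.1.IsLAlgebraic := ⟨_, hT', isLAlgebraic_twist_neg_half hC⟩
  obtain ⟨ρ, -, hcorr⟩ := hA π' hLalg ℓ ι
  refine ⟨ρ, ?_⟩
  filter_upwards [hcorr.1] with v hv α hα _hℓ
  obtain ⟨α', hα', hur, hch⟩ := hv
  refine ⟨hur, ?_⟩
  have hq : 0 < v.residueCard := Nat.zero_lt_of_lt v.one_lt_residueCard
  have hqC : (v.residueCard : ℂ) ≠ 0 := by exact_mod_cast hq.ne'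
  have hα'' : π'.1.HasSatakeParamAt v
      (α.map (((v.residueCard : ℂ) ^ (-((halfShift n : ℝ) : ℂ))) * ·)) :=
    AutomorphicRepData.HasSatakeParamAt.of_map_mulChar_detTwist_of_cpow hχ hWt hWt' hα
  have heq : α' = α.map (((v.residueCard : ℂ) ^ (-((halfShift n : ℝ) : ℂ))) * ·) :=
    AutomorphicRepData.hasSatakeParamAt_unique_holds π'.1 hα' hα''
  have hmap : α'.map (((v.residueCard : ℂ) ^ (-((((n : ℝ) - 1) / 2 : ℝ) : ℂ))) * ·) = α := by
    rw [heq, Multiset.map_map]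
    conv_rhs => rw [← Multiset.map_id α]
    refine Multiset.map_congr rfl fun a _ => ?_
    simp only [Function.comp_apply, id, halfShift, Complex.ofReal_neg, neg_neg]
    rw [← mul_assoc, ← Complex.cpow_add _ _ hqC, neg_add_cancel, Complex.cpow_zero, one_mul]
  have key := arithFrobPolyOfSatake_map_cpow_neg_half ι hq (Nat.one_le_iff_ne_zero.mpr hn.ne') α'
  rw [hmap] at key
  rwa [← key] at hch

/-- `E → PolarizableMultiplicitySatakeA m` for every `m` (clause (A) of E for its own `Rec`). -/
theorem family_of_top (m : ℕ)
    (hE : Summit.Langlands.Langlands.Theses.OrdinaryPrimeTransport.ReciprocityUpToIrreducibility) :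
    PolarizableMultiplicitySatakeA m := by
  intro n K _ _ _ hcpt π T hn hT hC _hW _hmult _hsd _hodd ℓ _ ι
  obtain ⟨Rec, hall⟩ := hE K
  exact cell_of_clauseA Rec (hall n hn hcpt).1 π T hn hT hC ℓ ι

/-- `E → rung`. -/
theorem MultiplicityThreePolarizableSatakeA_of_top
    (hE : Summit.Langlands.Langlands.Theses.OrdinaryPrimeTransport.ReciprocityUpToIrreducibility) :
    MultiplicityThreePolarizableSatakeA :=
  family_of_top 3 hE

end Summit.Langlands.Langlands.Cruxes.ReciprocityUpToIrreducibility.MultiplicityThreePolarizableSatakeA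

end
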